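import Mathlib.Tactic
import Literature.Computability.MetaComplexity.Frege

/-!
# A depth floor for refuting CNFs in `textbookFrege` (route ExpanderLinearGenerators, crux 3)

First helper file for item stmt-PneNP-11443
(`Summit.PneNP.PneNP.Theses.ExpanderLinearGenerators.LinearGeneratorDepthFregeHard`,
Krajíček's Problem 19.4.5 in universal-expander form); the system-specific half is
`ExpanderLinearGeneratorsLinearGeneratorDepthFregeHardDepthFloor.lean`.

* `conjAx_mem_of_isProofOf` — in the concrete Frege system `textbookFrege`, EVERY proof of a
  formula `¬(P ∧ Q)` contains the line `¬(P ∧ Q) ∨ ¬(¬P ∨ ¬Q)` (the instance at `(P, Q)` of the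
  first definitional axiom scheme for `conj`). Proof: a valuation that declares the one formula
  `conj P Q` true and is standard everywhere else validates every rule instance except that
  line, and falsifies `¬(P ∧ Q)`.
* `seven_le_of_isDepthProofOf_neg_ofCNF` — hence a depth-`d` `textbookFrege` proof (all lines of
  alternation depth `≤ d`) of `¬ ofCNF (C :: φ)`, where the tail `φ` contains a negative
  literal, forces `7 ≤ d`, although `altDepth (¬ ofCNF (C :: φ)) = 4`.
-/

namespace Summit.PneNP.PneNP.Theorems

set_option linter.dupNamespace false -- `Summit.PneNP.PneNP.…`: summit = sub-problem (D-0017)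

open Literature.Computability.Complexity Literature.Computability.Complexity.PropForm
open Literature.Computability.MetaComplexity

/-! ### Part 1. Every `textbookFrege` proof of `¬(P ∧ Q)` contains the `∧`-axiom at `(P, Q)` -/

/-- **A valuation perturbed at `(P, Q)` exists**: Boolean-valued, standard on constants, `¬` and
`∨`, and standard on `∧` except that the single formula `conj P Q` is declared `true`
(structural recursion on formulas; variables are sent to `false`). [folklore] -/
theorem exists_conjPerturbedVal (P Q : PropForm ℕ) :
    ∃ v : PropForm ℕ → Bool, (∀ b, v (const b) = b) ∧ (∀ φ, v (neg φ) = !v φ) ∧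
      (∀ φ ψ, v (disj φ ψ) = (v φ || v ψ)) ∧
      ∀ φ ψ, v (conj φ ψ) = (decide (φ = P ∧ ψ = Q) || (v φ && v ψ)) :=
  ⟨@PropForm.rec ℕ (fun _ => Bool) (fun _ => false) (fun b => b) (fun _ r => !r)
      (fun φ ψ r s => decide (φ = P ∧ ψ = Q) || (r && s)) (fun _ _ r s => r || s),
    fun _ => rfl, fun _ => rfl, fun _ _ => rfl, fun _ _ => rfl⟩

/-- One inference step of `textbookFrege` preserves truth under a valuation perturbed at
`(P, Q)`, unless its conclusion is the excluded line `¬(P ∧ Q) ∨ ¬(¬P ∨ ¬Q)`: the rules not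
mentioning `∧` are sound for any interpretation of `∧`, the second conjunction axiom stays true
when `conj P Q` is raised to `true`, and the first one is the excluded line. [folklore] -/
theorem conjPerturbedVal_of_isInferred {P Q : PropForm ℕ} {v : PropForm ℕ → Bool}
    (hconst : ∀ b, v (const b) = b) (hneg : ∀ φ, v (neg φ) = !v φ)
    (hdisj : ∀ φ ψ, v (disj φ ψ) = (v φ || v ψ))
    (hconj : ∀ φ ψ, v (conj φ ψ) = (decide (φ = P ∧ ψ = Q) || (v φ && v ψ)))
    {prev : List (PropForm ℕ)} {θ : PropForm ℕ} (hprev : ∀ p ∈ prev, v p = true)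
    (hinf : textbookFrege.IsInferred prev θ)
    (hθ : θ ≠ disj (neg (conj P Q)) (neg (disj (neg P) (neg Q)))) : v θ = true := by
  obtain ⟨r, hr, σ, hconc, hprem⟩ := hinf
  simp only [textbookFrege, List.mem_cons, List.not_mem_nil, or_false] at hr
  rcases hr with rfl | rfl | rfl | rfl | rfl | rfl | rfl | rfl | rfl <;>
    simp only [PropForm.subst, List.mem_cons, List.not_mem_nil, or_false, forall_eq_or_imp,
      forall_eq] at hconc hprem <;> subst hconc
  · -- (1) `⊢ ¬A ∨ A`
    simp only [hdisj, hneg]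
    cases v (σ 0) <;> rfl
  · -- (2) expansion `A ⊢ B ∨ A`
    have h0 := hprev _ hprem
    simp only [hdisj, h0, Bool.or_true]
  · -- (3) contraction `A ∨ A ⊢ A`
    have h0 := hprev _ hprem
    simpa [hdisj] using h0
  · -- (4) associativity `A ∨ (B ∨ C) ⊢ (A ∨ B) ∨ C`
    have h0 := hprev _ hprem
    simp only [hdisj, Bool.or_assoc] at h0 ⊢
    exact h0
  · -- (5) cut `A ∨ B, ¬A ∨ C ⊢ B ∨ C`
    have h0 := hprev _ hprem.1
    have h1 := hprev _ hprem.2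
    simp only [hdisj, hneg] at h0 h1 ⊢
    revert h0 h1
    cases v (σ 0) <;> cases v (σ 1) <;> cases v (σ 2) <;> simp
  · -- (6) `⊢ ¬(A ∧ B) ∨ ¬(¬A ∨ ¬B)`: the perturbed pair is excluded by `hθ`
    by_cases hc : σ 0 = P ∧ σ 1 = Q
    · obtain ⟨h0, h1⟩ := hc
      subst h0; subst h1
      exact absurd rfl hθ
    · simp only [hdisj, hneg, hconj, decide_eq_false hc, Bool.false_or]
      cases v (σ 0) <;> cases v (σ 1) <;> rfl
  · -- (7) `⊢ ¬¬(¬A ∨ ¬B) ∨ (A ∧ B)`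
    simp only [hdisj, hneg, hconj]
    cases v (σ 0) <;> cases v (σ 1) <;> simp
  · -- (8) `⊢ ⊤`
    exact hconst true
  · -- (9) `⊢ ¬⊥`
    rw [hneg, hconst]
    rfl

/-- All lines of a `textbookFrege` derivation from no hypotheses which avoids the line
`¬(P ∧ Q) ∨ ¬(¬P ∨ ¬Q)` are true under a valuation perturbed at `(P, Q)`. [folklore] -/
theorem conjPerturbedVal_of_isDerivation {P Q : PropForm ℕ} {v : PropForm ℕ → Bool}
    (hconst : ∀ b, v (const b) = b) (hneg : ∀ φ, v (neg φ) = !v φ)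
    (hdisj : ∀ φ ψ, v (disj φ ψ) = (v φ || v ψ))
    (hconj : ∀ φ ψ, v (conj φ ψ) = (decide (φ = P ∧ ψ = Q) || (v φ && v ψ)))
    {π : List (PropForm ℕ)} (hπ : textbookFrege.IsDerivation ∅ π)
    (hPQ : disj (neg (conj P Q)) (neg (disj (neg P) (neg Q))) ∉ π) :
    ∀ ψ ∈ π, v ψ = true := by
  suffices H : ∀ (k : ℕ) (hk : k < π.length), v π[k] = true by
    intro ψ hψ
    obtain ⟨k, hk, rfl⟩ := List.getElem_of_mem hψ
    exact H k hk
  intro k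
  induction k using Nat.strong_induction_on with
  | _ k ih =>
    intro hk
    rcases hπ k hk with hm | hinf
    · exact absurd hm (Set.notMem_empty _)
    · refine conjPerturbedVal_of_isInferred hconst hneg hdisj hconj (fun p hp => ?_) hinf
        fun h => hPQ (h ▸ List.getElem_mem hk)
      obtain ⟨j, hj, hj'⟩ := List.getElem_of_mem hp
      rw [List.length_take] at hj
      rw [← hj', List.getElem_take]
      exact ih j (by omega) (by omega)

/-- **Every `textbookFrege` proof of `¬(P ∧ Q)` contains the line `¬(P ∧ Q) ∨ ¬(¬P ∨ ¬Q)`**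
(under the perturbed valuation every other line is true and `¬(P ∧ Q)` is false). [folklore] -/
theorem conjAx_mem_of_isProofOf {π : List (PropForm ℕ)} {P Q : PropForm ℕ}
    (h : textbookFrege.IsProofOf π (neg (conj P Q))) :
    disj (neg (conj P Q)) (neg (disj (neg P) (neg Q))) ∈ π := by
  by_contra hPQ
  obtain ⟨v, hconst, hneg, hdisj, hconj⟩ := exists_conjPerturbedVal P Q
  have hlast : neg (conj P Q) ∈ π := List.mem_of_getLast? h.2
  have := conjPerturbedVal_of_isDerivation hconst hneg hdisj hconj h.1 hPQ _ hlast
  rw [hneg, hconj] at this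
  simp at this

/-! ### Part 2. Alternation depth of the forced line -/

/-- The forced line is at least `4` deeper than `Q` read under a `¬`:
`altDepth (¬(P∧Q) ∨ ¬(¬P ∨ ¬Q)) ≥ altDepthAux 1 Q + 4`. [folklore] -/
theorem altDepthAux_add_four_le_altDepth_conjAx (P Q : PropForm ℕ) :
    altDepthAux 1 Q + 4 ≤ altDepth (disj (neg (conj P Q)) (neg (disj (neg P) (neg Q)))) := by
  simp [altDepth, altDepthAux]

/-- A depth-`d` proof of `¬(P ∧ Q)` needs `d ≥ altDepthAux 1 Q + 4`. [folklore] -/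
theorem altDepthAux_add_four_le_of_isDepthProofOf {d : ℕ} {π : List (PropForm ℕ)}
    {P Q : PropForm ℕ} (h : textbookFrege.IsDepthProofOf d π (neg (conj P Q))) :
    altDepthAux 1 Q + 4 ≤ d :=
  (altDepthAux_add_four_le_altDepth_conjAx P Q).trans (h.2 _ (conjAx_mem_of_isProofOf h.1))

/-! ### Part 3. CNF formulas: the forced line for `¬ ofCNF (C :: φ)` has depth `≥ 7` -/

/-- `ofCNF` of a nonempty clause list is the conjunction of the first clause formula with the
`ofCNF` of the rest (definitional). [folklore] -/
theorem ofCNF_cons (C : Clause ℕ) (φ : CNF ℕ) :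
    ofCNF (C :: φ) = conj (List.foldr (fun (l : Literal ℕ) (d : PropForm ℕ) =>
      disj (if l.2 then var l.1 else neg (var l.1)) d) (const false) C) (ofCNF φ) := rfl

/-- A clause with a negative literal has a `¬` inside its `∨`-block. [folklore] -/
theorem one_le_altDepthAux_three_clauseForm :
    ∀ {C : Clause ℕ}, (∃ l ∈ C, l.2 = false) → 1 ≤ altDepthAux 3
      (List.foldr (fun (l : Literal ℕ) (d : PropForm ℕ) =>
        disj (if l.2 then var l.1 else neg (var l.1)) d) (const false) C)
  | [], h => by simp at h
  | l :: C, h => by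
    obtain ⟨l', hl', h2⟩ := h
    rw [List.foldr_cons]
    rcases List.mem_cons.1 hl' with rfl | hl'
    · rw [h2]
      simp [altDepthAux]
    · have := one_le_altDepthAux_three_clauseForm ⟨l', hl', h2⟩
      simp only [altDepthAux, if_true]
      omega

/-- Below a `∧`, a clause with a negative literal contributes alternation depth `≥ 2`. [folklore] -/
theorem two_le_altDepthAux_two_clauseForm {C : Clause ℕ} (h : ∃ l ∈ C, l.2 = false) :
    2 ≤ altDepthAux 2
      (List.foldr (fun (l : Literal ℕ) (d : PropForm ℕ) =>
        disj (if l.2 then var l.1 else neg (var l.1)) d) (const false) C) := by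
  have h1 := one_le_altDepthAux_three_clauseForm h
  obtain ⟨l, hl, -⟩ := h
  cases C with
  | nil => simp at hl
  | cons l₀ C =>
    rw [List.foldr_cons] at h1 ⊢
    simp only [altDepthAux] at h1 ⊢
    simp only [if_true, show ((2 : ℕ) = 3) = False by simp, if_false] at h1 ⊢
    omega

/-- Below a `∧`, a CNF with a negative literal contributes alternation depth `≥ 2`. [folklore] -/
theorem two_le_altDepthAux_two_ofCNF :
    ∀ {φ : CNF ℕ}, (∃ C ∈ φ, ∃ l ∈ C, l.2 = false) → 2 ≤ altDepthAux 2 (ofCNF φ)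
  | [], h => by simp at h
  | C :: φ, h => by
    obtain ⟨C', hC', hl⟩ := h
    rw [ofCNF_cons]
    simp only [altDepthAux, if_true]
    rcases List.mem_cons.1 hC' with rfl | hC'
    · have := two_le_altDepthAux_two_clauseForm hl
      omega
    · have := two_le_altDepthAux_two_ofCNF ⟨C', hC', hl⟩
      omega

/-- Below a `¬`, a nonempty CNF with a negative literal has alternation depth `≥ 3`. [folklore] -/
theorem three_le_altDepthAux_one_ofCNF {φ : CNF ℕ} (h : ∃ C ∈ φ, ∃ l ∈ C, l.2 = false) :
    3 ≤ altDepthAux 1 (ofCNF φ) := by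
  have h2 := two_le_altDepthAux_two_ofCNF h
  obtain ⟨C, hC, -⟩ := h
  cases φ with
  | nil => simp at hC
  | cons C₀ φ =>
    rw [ofCNF_cons] at h2 ⊢
    simp only [altDepthAux] at h2 ⊢
    simp only [if_true, show ((1 : ℕ) = 2) = False by simp, if_false] at h2 ⊢
    omega

/-- **Depth floor for refuting a CNF in `textbookFrege`.** If the tail `φ` of a clause list
`C :: φ` contains a negative literal, every depth-`d` `textbookFrege` proof of `¬ ofCNF (C :: φ)`
has `d ≥ 7`: it contains the conjunction axiom at `(clause formula of C, ofCNF φ)`, of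
alternation depth `≥ altDepthAux 1 (ofCNF φ) + 4 ≥ 7`. [folklore] -/
theorem seven_le_of_isDepthProofOf_neg_ofCNF {d : ℕ} {π : List (PropForm ℕ)} {C : Clause ℕ}
    {φ : CNF ℕ} (hφ : ∃ D ∈ φ, ∃ l ∈ D, l.2 = false)
    (h : textbookFrege.IsDepthProofOf d π (neg (ofCNF (C :: φ)))) : 7 ≤ d := by
  rw [ofCNF_cons] at h
  have h1 := altDepthAux_add_four_le_of_isDepthProofOf h
  have h2 := three_le_altDepthAux_one_ofCNF hφ
  omega

end Summit.PneNP.PneNP.Theorems
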